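import Literature.NumberTheory.EllipticCurves.CofreeContinuousRepNewform
import Literature.NumberTheory.EllipticCurves.BigGaloisRepSelmer
import Literature.NumberTheory.GaloisRepresentations.ArtinRestriction
import Literature.NumberTheory.GaloisRepresentations.DecompositionGroupOfCompletion
import Literature.NumberTheory.Automorphic.AdicCompletionLocalField
import HarnessLib

/-!
# `A_g = K²/𝒪²` of an ordinary newform datum: `p`-divisible, and unramified at `w ∤ Mp` over any
# number field (Literature twins of the member lemmas of the Road FF)

Cell `bsd-stepL`, typer lane (plan g31 RULING 14 (A), exit (α) for the orphan fact
`SkinnerUrban2014.lemma319_finite_XBig_newform`): the generic newform-datum lemmas that the prover seat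
imc-p1 proved inside `Summits/…/Theorems/ErratumRoadFiveIMCDivMemberDivisible.lean` (namespace
`Summit.…RoadFFMember`, not importable from `Literature/`), RE-HOMED as Literature twins with the same
statements and proofs (the Summits copies are untouched):

* `GreenbergSelmer.Cofree.divisible` — `A = Fⁿ/𝒪ⁿ` is `p`-divisible (`char F = 0`);
* `GreenbergSelmer.OrdinaryNewformDatum.cofreeRep_apply_eq_self_of_apply_eq_one` — `ρ_g(τ) = 1 ⇒ τ` acts
  trivially on `A_g`;
* `Literature.NumberTheory.EllipticCurves.natCast_primesEquiv_mem_asIdeal` — the rational prime below a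
  finite place of `ℚ` lies in it;
* `GreenbergSelmer.OrdinaryNewformDatum.cofreeRepOver_apply_eq_self_of_mem_absInertia` — `A_g|_{Γ_K}` is
  unramified at every finite `w ∤ Mp` (EPW §3.1: `ρ_f` unramified at `ℓ ∤ Np`; Neukirch II (9.6));
* `GreenbergSelmer.OrdinaryNewformDatum.cofreeRepOver_localMap_inr_apply_eq_self` — the same in the
  `BigGaloisRep.localMap K (Sum.inr w)` currency of the typed [SU14] Lemma 3.1.9 (`hunr`).

Theorems only; no named fact, no `sorry`, no instance.

References: [EmertonPollackWeston2006] §3.1 (p. 17); [Skinner2016PacificMC] §2.3, proof of Lemma 2.3.1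
(p. 180); [NeukirchANT1999] Ch. I §8, Ch. II §9 Prop. (9.6); [Castella2018Erratum] Lemma 2.1 (p. 2).
-/

noncomputable section

open scoped MatrixGroups ModularForm
open Field IsDedekindDomain NumberField CongruenceSubgroup
open Literature.NumberTheory.GaloisRepresentations Literature.NumberTheory.EllipticCurves
open Literature.NumberTheory.EllipticCurves.ModularForms Literature.NumberTheory.EllipticCurves.BigGaloisRep
open Literature.NumberTheory.Automorphic

namespace Literature.NumberTheory.EllipticCurves

/-- The rational prime `ℓ_v` below a finite place `v` of `ℚ` lies in `v` (twin of the Road-FF member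
lemma). [cite: NeukirchANT1999, Ch. I §8 (primes of `ℤ` and places of `ℚ`)] -/
theorem natCast_primesEquiv_mem_asIdeal (v : HeightOneSpectrum (𝓞 ℚ)) :
    (((Rat.HeightOneSpectrum.primesEquiv v : Nat.Primes) : ℕ) : 𝓞 ℚ) ∈ v.asIdeal := by
  have h : Rat.HeightOneSpectrum.natGenerator v ∣ Rat.HeightOneSpectrum.natGenerator v := dvd_rfl
  rw [Rat.HeightOneSpectrum.natGenerator_dvd_iff, Ideal.mem_map_of_equiv] at h
  obtain ⟨y, hy, hyv⟩ := h
  have hy' : y = ((Rat.HeightOneSpectrum.natGenerator v : ℕ) : 𝓞 ℚ) := by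
    apply (Rat.IsIntegralClosure.intEquiv (𝓞 ℚ)).injective
    rw [hyv, map_natCast]
  rw [hy'] at hy
  exact hy

namespace GreenbergSelmer

section Cofree

variable {G : Type*} [Group G] [TopologicalSpace G] {𝒪 : Type*} [CommRing 𝒪] [TopologicalSpace 𝒪] {n : ℕ}
  (F : Type*) [Field F] [Algebra 𝒪 F] [CharZero F]

/-- **`A = Fⁿ/𝒪ⁿ` is `p`-divisible** for `F` of characteristic `0` (`x mod 𝒪ⁿ = p • (p⁻¹ x mod 𝒪ⁿ)`);
twin of the Road-FF member lemma `cofree_divisible`.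
[cite: EmertonPollackWeston2006, §3.1 (`A_f = K/𝒪 ⊗ T_f`)] [cite: Skinner2016PacificMC, §2.3, proof of Lemma 2.3.1 (p. 180)] -/
theorem Cofree.divisible (ρ : FramedRep G 𝒪 n) {p : ℕ} (hp : p ≠ 0) :
    ∀ a : Cofree ρ F, ∃ b : Cofree ρ F, p • b = a := by
  intro a
  obtain ⟨x, rfl⟩ := cofreeMk_surjective F ρ a
  refine ⟨cofreeMk F ρ ((p : F)⁻¹ • x), ?_⟩
  rw [← map_nsmul, ← Nat.cast_smul_eq_nsmul F, smul_smul, mul_inv_cancel₀ (Nat.cast_ne_zero.mpr hp),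
    one_smul]

end Cofree

namespace OrdinaryNewformDatum

variable {M : ℕ} {k : ℤ} {g : CuspForm (Gamma0 M) k} {p : ℕ} [Fact p.Prime]
  {ι : coeffField g →+* PadicAlgCl p} (Δ : OrdinaryNewformDatum g p ι)
  (K : Type) [Field K] [NumberField K]

/-- An element `τ ∈ Γ_ℚ` with `ρ_g(τ) = 1` acts trivially on `A_g = Kⁿ/𝒪ⁿ` (twin of the Road-FF member
lemma). [cite: EmertonPollackWeston2006, §3.1 ("with `G_ℚ`-action via `ρ_f`")] -/
theorem cofreeRep_apply_eq_self_of_apply_eq_one {τ : absoluteGaloisGroup ℚ} (hτ : Δ.ρ τ = 1)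
    (a : Cofree Δ.ρ (padicCoeffField ι)) : Δ.cofreeRep τ a = a := by
  obtain ⟨x, rfl⟩ := cofreeMk_surjective (padicCoeffField ι) Δ.ρ a
  rw [OrdinaryNewformDatum.cofreeRep_apply, smul_cofreeMk, fracRepresentation_apply_apply, hτ, Units.val_one,
    Matrix.map_one _ (map_zero _) (map_one _), Matrix.one_mulVec]

/-- **`A_g|_{Γ_K}` is unramified at every finite place `w ∤ M p` of `K`**: the inertia group `I_{K_w}`,
restricted to `Γ_K` along the chosen `absGaloisRestrict K K_w`, acts trivially on `A_g` — `ρ_g` is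
unramified at the prime `ℓ ∤ M p` below `w` (`Δ.charpoly`), so is `ρ_g|_{Γ_K}` at `w`
(`FramedGaloisRep.isUnramifiedAt_restrictField`), and `res(I_{K_w})` is the inertia group of the chosen
prime `𝔓₀ ∣ w` (`inertia_adicCompletionPrime_eq_map_absInertia`). Twin of the Road-FF member lemma.
[cite: EmertonPollackWeston2006, §3.1 (p. 17: `ρ_f` unramified at `ℓ ∤ Np`)] [cite: NeukirchANT1999, Ch. II §9 Prop. (9.6)]
[cite: Castella2018Erratum, Lemma 2.1 (p. 2, "Σ contains all primes `v ∤ p` where `T_g` is ramified")] -/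
theorem cofreeRepOver_apply_eq_self_of_mem_absInertia (w : HeightOneSpectrum (𝓞 K))
    (hMw : ((M : ℕ) : 𝓞 K) ∉ w.asIdeal) (hpw : ((p : ℕ) : 𝓞 K) ∉ w.asIdeal)
    {σ : absoluteGaloisGroup (w.adicCompletion K)} (hσ : σ ∈ absInertia (w.adicCompletion K))
    (a : Cofree Δ.ρ (padicCoeffField ι)) :
    Δ.cofreeRepOver K (absGaloisRestrict K (w.adicCompletion K) σ) a = a := by
  -- the place `v` of `ℚ` below `w` and its prime `ℓ`
  set v : HeightOneSpectrum (𝓞 ℚ) := w.under (𝓞 ℚ) with hv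
  have hvw : w.asIdeal.under (𝓞 ℚ) = v.asIdeal := rfl
  have hℓv := natCast_primesEquiv_mem_asIdeal v
  have hℓw : (((Rat.HeightOneSpectrum.primesEquiv v : Nat.Primes) : ℕ) : 𝓞 K) ∈ w.asIdeal := by
    have h : algebraMap (𝓞 ℚ) (𝓞 K) (((Rat.HeightOneSpectrum.primesEquiv v : Nat.Primes) : ℕ) : 𝓞 ℚ) ∈
        w.asIdeal := by
      rw [← Ideal.mem_comap]; exact hℓv
    rwa [map_natCast] at h
  have hℓM : ¬ ((Rat.HeightOneSpectrum.primesEquiv v : Nat.Primes) : ℕ) ∣ M := by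
    rintro ⟨c, hc⟩
    exact hMw (by rw [hc, Nat.cast_mul]; exact w.asIdeal.mul_mem_right _ hℓw)
  have hℓp : ((Rat.HeightOneSpectrum.primesEquiv v : Nat.Primes) : ℕ) ≠ p := by
    rintro h
    exact hpw (h ▸ hℓw)
  -- `ρ_g|_{Γ_K}` is unramified at `w`, hence kills `res(I_{K_w}) = I_{𝔓₀}`
  have hunr : (Δ.ρ.restrictField K).IsUnramifiedAt w :=
    Δ.ρ.isUnramifiedAt_restrictField hvw (Δ.charpoly v hℓM hℓp).1
  have h1 : (Δ.ρ.restrictField K) (absGaloisRestrict K (w.adicCompletion K) σ) = 1 :=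
    hunr _ (adicCompletionPrime_mem_primesAbove K w) _ (by
      rw [inertia_adicCompletionPrime_eq_map_absInertia]
      exact Subgroup.mem_map_of_mem _ hσ)
  rw [FramedGaloisRep.restrictField_apply] at h1
  rw [ContinuousRep.restrict_apply]
  exact cofreeRep_apply_eq_self_of_apply_eq_one Δ h1 a

/-- **The `hunr` hypothesis of the typed [SU14] Lemma 3.1.9 (`SkinnerUrban2014.lemma319_finite_XBig`,
`moduleFinite_XBig_of_lemma319`) for `A_g|_{Γ_K}`**, for any set `Σ` of places outside which `M` is a unit:
at every finite `w ∉ Σ` with `w ∤ p`, the inertia group (`BigGaloisRep.localMap K (Sum.inr w)`) acts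
trivially on `A_g`. [cite: Castella2018Erratum, Lemma 2.1 (p. 2, "Σ contains all primes `v ∤ p` where `T_g` is ramified")] -/
theorem cofreeRepOver_localMap_inr_apply_eq_self (S : Set (HeightOneSpectrum (𝓞 K)))
    (hSM : ∀ w : HeightOneSpectrum (𝓞 K), w ∉ S → ((M : ℕ) : 𝓞 K) ∉ w.asIdeal) :
    ∀ w : HeightOneSpectrum (𝓞 K), w ∉ S → ((p : ℕ) : 𝓞 K) ∉ w.asIdeal →
      ∀ (σ : LocalGroup K (Sum.inr w)) (a : Cofree Δ.ρ (padicCoeffField ι)),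
        Δ.cofreeRepOver K (localMap K (Sum.inr w) σ) a = a :=
  fun w hw hpw σ a ↦
    cofreeRepOver_apply_eq_self_of_mem_absInertia Δ K w (hSM w hw) hpw (σ := inertiaIncl K w σ) σ.2 a

end OrdinaryNewformDatum

end GreenbergSelmer

end Literature.NumberTheory.EllipticCurves
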